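import Summits.Ventures.QEC.Theorems.BB288DistanceCertificateWeightEighteenZLogical
import Summits.Ventures.QEC.Theorems.BB288DistanceCertificateTwelveLogicalQubits288
import Summits.Ventures.QEC.Census.BB.BB144.OrbitBZ
import HarnessLib

/-!
# `[[288,12,18]]` — the route items MODULO a flat `Z` lower bound (lane-agnostic transport + parity step)
# (route BB288DistanceCertificate, items NoZLogicalBelowEighteen stmt-Ventures-19833 and Target stmt-Ventures-19832)

Every kernel lane sized for the `[[288,12,18]]` lower bound — the COVER REDUCTION (qec-search-9 ε lane, director-qec R29:
`Census/CertCover*.lean`), the fold recursion (qec-type-11), a compressed `bz_aut` replay — ends in the same flat statement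
about the certificate words (qec-type-02's `Census.bb288HX` / `bb288HZ`, `Census/BB/BB288Data.lean`, kernel-checked equal
to the typed matrices `BB.bb288.HXFlat` / `HZFlat`):

  `LowZ16 : ∀ w : Fin 288 → ZMod 2, rowMatrix 288 bb288HX *ᵥ w = 0 → w ∉ rowSpace (rowMatrix 288 bb288HZ) → 16 < ‖w‖`

(the cover reduction certifies «no non-trivial `Z`-logical of weight ≤ 16»; written OUT as the hypothesis of each theorem below —
no `def`, so the file is proof-only). This file does, ONCE and for every lane, the two
remaining steps, both KERNEL with standard axioms and no enumeration: PARITY — `𝟙 ∈ rs H^X` because `|A| = |B| = 3` are odd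
(`BB.isBBPoly_bb288`, type-05; `BB.even_hammingNorm_of_HXFlat_mulVec_eq_zero`, type-12), so every `Z`-logical has even
weight and `16 < ‖w‖` upgrades to `18 ≤ ‖w‖` — and TRANSPORT to the typed code `BB.bb288` on `Mono 12 12 ⊕ Mono 12 12`
(type-05's `BB.Code.zLowerBound_of_flat` through `rowMatrix_bb288HX/HZ`). Results:
* `eighteen_le_flat_of_lowZ16 : LowZ16 → ∀ w, … → 18 ≤ ‖w‖`;
* `noZLogicalBelowEighteen_of_lowZ16 : LowZ16 → NoZLogicalBelowEighteen` (the route item's statement verbatim);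
* `target288_of_lowZ16 : LowZ16 → Target` (= `BB288_12_18_claim`, through the route's `closes` with the CLOSED items
  `weightEighteenZLogical_proof` p477026 and `TwelveLogicalQubits288_proof`),
where `LowZ16` abbreviates (in this docstring only) the flat hypothesis spelled out in each statement.
So the lane that lands `LowZ16` closes both open items with one-line closers `… := noZLogicalBelowEighteen_of_lowZ16 lowZ16`.
HONEST FRAMING: nothing here proves the lower bound; `[[288,12,18]]` stays COMPUTED(A∧B) until a lane supplies `LowZ16`
(R29 wording guard). No certificate data is read here.
-/

namespace Summit.Ventures.QEC.Census.BB288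

open Matrix Literature.InformationTheory.QuantumCodes Literature.InformationTheory.QuantumCodes.BB

/-- **Parity step**: `16 < ‖w‖` and `‖w‖` even (all-ones vector in `rs H^X`: `|A| = |B| = 3` odd) give `18 ≤ ‖w‖`. -/
theorem eighteen_le_flat_of_lowZ16
    (h : (∀ w : Fin 288 → ZMod 2, rowMatrix 288 bb288HX *ᵥ w = 0 → w ∉ rowSpace (rowMatrix 288 bb288HZ) → 16 < hammingNorm w))
    (w : Fin 288 → ZMod 2) (hw : rowMatrix 288 bb288HX *ᵥ w = 0)
    (hw' : w ∉ rowSpace (rowMatrix 288 bb288HZ)) : 18 ≤ hammingNorm w := by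
  have hlt := h w hw hw'
  have hXf : BB.bb288.HXFlat *ᵥ w = 0 := by rw [← rowMatrix_bb288HX]; exact hw
  have hev : Even (hammingNorm w) :=
    BB.even_hammingNorm_of_HXFlat_mulVec_eq_zero BB.bb288 (odd_hammingNorm_of_isBBPoly isBBPoly_bb288.1)
      (odd_hammingNorm_of_isBBPoly isBBPoly_bb288.2) hXf
  obtain ⟨r, hr⟩ := hev
  omega

/-- **Item NoZLogicalBelowEighteen modulo the flat bound**: transport to the typed code `BB.bb288` (type-05's
`zLowerBound_of_flat` through type-02's index identities). -/
theorem noZLogicalBelowEighteen_of_lowZ16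
    (h : (∀ w : Fin 288 → ZMod 2, rowMatrix 288 bb288HX *ᵥ w = 0 → w ∉ rowSpace (rowMatrix 288 bb288HZ) → 16 < hammingNorm w)) :
    Summit.Ventures.QEC.Theses.BB288DistanceCertificate.NoZLogicalBelowEighteen :=
  BB.bb288.zLowerBound_of_flat
    (D := CSSCode.ofMatrices (rowMatrix 288 bb288HX) (rowMatrix 288 bb288HZ) comm_flat288)
    rowMatrix_bb288HX rowMatrix_bb288HZ (eighteen_le_flat_of_lowZ16 h)

/-- **Item Target (= `BB288_12_18_claim`) modulo the flat bound**: the route's `closes` with the two CLOSED items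
(weight-18 witness p477026, `k = 12`). -/
theorem target288_of_lowZ16
    (h : (∀ w : Fin 288 → ZMod 2, rowMatrix 288 bb288HX *ᵥ w = 0 → w ∉ rowSpace (rowMatrix 288 bb288HZ) → 16 < hammingNorm w)) : Summit.Ventures.QEC.Theses.BB288DistanceCertificate.Target :=
  Summit.Ventures.QEC.Theses.BB288DistanceCertificate.closes (noZLogicalBelowEighteen_of_lowZ16 h)
    weightEighteenZLogical_proof Summit.Ventures.QEC.Theorems.TwelveLogicalQubits288_proof

end Summit.Ventures.QEC.Census.BB288
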